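import Summits.BirchSwinnertonDyer.BirchSwinnertonDyer.Theorems.ByReductionTypeAtTwoAdditivePotGoodLowerHalfT0NarrowRankLayerTwoOrder
import HarnessLib

/-!
# Route `ByReductionTypeAtTwo` (rung K4), crux C3″ `AdditivePotGoodLowerHalfAtTwo` (item stmt-BirchSwinnertonDyer-22617):
# RESIDUE MAPS `𝓞_{A₂} → 𝔽_ℓ` ON THE LAYER-TWO FIELD `A₂ = ℚ(θ) ⊔ ℚ_2` OF A TOTALLY REAL CUBIC FIELD, through the order `ℤ[θ, e]`
# (the non-square witnesses of the kernel discharge of (hlow) `2^a ≤ #(U⁺/U²)(A₂)` in the `m = 2` narrow-rank stamps;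
# a `--supports 22617` helper file; seat `bsd-2adic-k4-w2` GEN 16)

HONEST FRAMING (cell `bsd-2adic`, D-0036/D-0054/D-0152): GENERIC KERNEL lemmas (any irreducible monic integer cubic with a totally real
root field); no elliptic curve, no named fact, no `sorry`, no definition.  They close nothing at the `∀`-level; nothing booked; BSD is
not proved by any of this.

CONTENT.  `θ` a root of the irreducible cubic `h = X³ + pX² + qX + r` (`ℚ(θ)` totally real), `e ∈ ℚ_2` a root of `Ψ₂ = X⁴ − 4X² + 2`,
`A₂ = ℚ(θ) ⊔ ℚ_2 ⊂ ℚ̄` (degree `12`).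
* **`forall_eq_zero_of_sum_pow_gen_eq_zero`**, **`forall_eq_zero_of_sum_pow_layer_two_eq_zero`** — `1, θ, θ²` is `ℚ`-independent in `ℚ(θ)`
  (power basis) and `1, e, e², e³` is `ℚ(θ)`-independent in `A₂` (the minimal polynomial of `e` over the odd-degree field is `Ψ₂`,
  `NestedSqrtTwo.minpoly_eq_of_odd_finrank`; Mathlib `linearIndependent_pow`).
* **`exists_ringHom_ringOfIntegers_sup_layer_two_zmod`** — for every prime `ℓ` with `ℓ ∤ 16·disc(h)` and every pair `(x, y) ∈ 𝔽_ℓ²` with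
  `h(x) = 0`, `Ψ₂(y) = 0` there is a RING MAP `φ : 𝓞_{A₂} → 𝔽_ℓ` with `φ(θ) = x`, `φ(e) = y`.  Construction: the abstract order
  `T = (ℤ[X]/h)[Y]/Ψ₂` (Mathlib `AdjoinRoot`, power bases of monic quotients) maps to `A₂` by `X ↦ θ`, `Y ↦ e`, INJECTIVELY by the two
  independence lemmas, so its image `R = ℤ[θ, e]` carries `φ₀ = ` (evaluation `X ↦ x`, `Y ↦ y`); and `N · 𝓞_{A₂} ⊆ R` for `N = 16·disc(h)`
  (`sixteen_mul_discr_mul_eq_sum_sup_layer_two`), so `z ↦ N̄⁻¹ · φ₀(N z)` is a ring map on all of `𝓞_{A₂}` (the shape of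
  `Literature.NumberTheory.NumberFields.nonempty_ringHom_zmod_of_dvd_eval`, with the order `ℤ[θ, e]` in place of `ℤ[θ]`).
  `exists_ringHom_ringOfIntegers_sup_layer_two_zmod'` is the same with `ℓ.Prime` a hypothesis instead of a `Fact` instance (so callers can
  `decide` closed `𝔽_ℓ`-arithmetic with no local instance in scope).
With `AddKatoTwo.not_exists_eq_sq_of_map_not_isSquare` (GEN 15) each such `φ` is a non-square witness: `φ(u)` a non-residue ⟹ `u ≠ ε²`.

References: [Marcus1977] Ch. 2 Ex. 27, Ex. 41, Ch. 3 Thm. 27 (primes of degree one via `ℤ[θ] → 𝔽_ℓ`); [NeukirchANT1999] Ch. I §8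
(Dedekind–Kummer); [Cohen1993] §4.1.3, §6.3 (residue checks of unit squares); [Washington1997] §13.1.
-/

set_option autoImplicit false
-- sibling precedent: the directory name repeats the summit name
set_option linter.dupNamespace false

noncomputable section

open scoped Classical IntermediateField NumberField Polynomial

namespace Summit.BirchSwinnertonDyer.BirchSwinnertonDyer.Theorems.AddKatoTwo

open Polynomial IsDedekindDomain NumberField Field IntermediateField
  Literature.NumberTheory.EllipticCurves Literature.NumberTheory.EllipticCurves.ZpExtension
  Literature.NumberTheory.IwasawaTheory Literature.NumberTheory.NumberFields
  Literature.NumberTheory.GaloisRepresentations Literature.Geometry.Kaehler.ComplexTorus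

variable {p q r : ℤ} {θ : AlgebraicClosure ℚ}

/-! ## §1 Independence of `1, θ, θ²` over `ℚ` and of `1, e, e², e³` over `ℚ(θ)` -/

/-- **`Σ_{i<3} d_i θ^i = 0` with `d_i ∈ ℤ` forces `d = 0`** (`θ` a root of the irreducible cubic: `1, θ, θ²` is the power basis of `ℚ(θ)`).
[cite: Marcus1977, Ch. 2 (power bases)] -/
theorem forall_eq_zero_of_sum_pow_gen_eq_zero (hirr : Irreducible (Cubic.toPoly ⟨1, (p : ℚ), q, r⟩))
    (hθ : aeval θ (Cubic.toPoly ⟨1, (p : ℚ), q, r⟩) = 0) {n : ℕ} (hn : n = 3) (d : Fin n → ℤ)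
    (hd : ∑ i : Fin n, (d i : ↥ℚ⟮θ⟯) * AdjoinSimple.gen ℚ θ ^ (i : ℕ) = 0) : ∀ i, d i = 0 := by
  subst hn
  have hfm : (Cubic.toPoly ⟨1, (p : ℚ), q, r⟩).Monic := Cubic.monic_of_a_eq_one'
  have hθQ : IsIntegral ℚ θ := ⟨_, hfm, by rwa [← aeval_def]⟩
  have hminθ : minpoly ℚ θ = Cubic.toPoly ⟨1, (p : ℚ), q, r⟩ := (minpoly.eq_of_irreducible_of_monic hirr hθ hfm).symm
  have hndθ : (minpoly ℚ θ).natDegree = 3 := by rw [hminθ]; exact Cubic.natDegree_of_a_ne_zero' one_ne_zero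
  set pb : PowerBasis ℚ ↥ℚ⟮θ⟯ := IntermediateField.adjoin.powerBasis hθQ with hpb
  have hgen : pb.gen = AdjoinSimple.gen ℚ θ := by rw [hpb, IntermediateField.adjoin.powerBasis_gen]
  have hdim : pb.dim = 3 := by rw [hpb, IntermediateField.adjoin.powerBasis_dim, hndθ]
  have hb : LinearIndependent ℚ fun i : Fin 3 => AdjoinSimple.gen ℚ θ ^ (i : ℕ) := by
    have h0 := pb.basis.linearIndependent
    rw [PowerBasis.coe_basis, hgen] at h0
    have hcomp : (fun i : Fin 3 => AdjoinSimple.gen ℚ θ ^ (i : ℕ)) ∘ (finCongr hdim) =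
        fun i : Fin pb.dim => AdjoinSimple.gen ℚ θ ^ (i : ℕ) := by
      funext i; simp
    rw [← hcomp] at h0
    exact (linearIndependent_equiv (finCongr hdim)).mp h0
  have h := Fintype.linearIndependent_iff.mp hb (fun i => (d i : ℚ)) (by
    rw [← hd]
    refine Finset.sum_congr rfl fun i _ => ?_
    rw [Algebra.smul_def, eq_ratCast, Rat.cast_intCast])
  intro i
  exact_mod_cast h i

set_option maxHeartbeats 800000 in
/-- **`Σ_{k<4} c_k e^k = 0` with `c_k ∈ ℚ(θ)` forces `c = 0`** in `A₂ = ℚ(θ) ⊔ ℚ_2` (`e ∈ ℚ_2` a root of `Ψ₂`): the minimal polynomial of `e` over the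
odd-degree field `ℚ(θ)` is `Ψ₂` (`NestedSqrtTwo.minpoly_eq_of_odd_finrank`), so `1, e, e², e³` is `ℚ(θ)`-independent (`linearIndependent_pow`).
[cite: Washington1997, §13.1 (`[Kℚ_n : K] = 2ⁿ` when `K ∩ ℚ_∞ = ℚ`)] -/
theorem forall_eq_zero_of_sum_pow_layer_two_eq_zero (hirr : Irreducible (Cubic.toPoly ⟨1, (p : ℚ), q, r⟩))
    (hθ : aeval θ (Cubic.toPoly ⟨1, (p : ℚ), q, r⟩) = 0)
    (hreal : haveI : FiniteDimensional ℚ ↥ℚ⟮θ⟯ :=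
        IntermediateField.adjoin.finiteDimensional ⟨_, Cubic.monic_of_a_eq_one', by rwa [← aeval_def]⟩
      haveI : NumberField ↥ℚ⟮θ⟯ := NumberField.mk
      IsTotallyReal ↥ℚ⟮θ⟯)
    {e : AlgebraicClosure ℚ} (he : e ∈ (CyclotomicZp.zpExtension 2).layer 2) (he0 : (fun x : AlgebraicClosure ℚ => x ^ 2 - 2)^[2] e = 0)
    {n : ℕ} (hn : n = 4) (c : Fin n → ↥ℚ⟮θ⟯)
    (hc : ∑ k : Fin n, inclusion (le_sup_left : ℚ⟮θ⟯ ≤ ℚ⟮θ⟯ ⊔ (CyclotomicZp.zpExtension 2).layer 2) (c k) *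
        (⟨e, (le_sup_right : (CyclotomicZp.zpExtension 2).layer 2 ≤ _) he⟩ : ↥(ℚ⟮θ⟯ ⊔ (CyclotomicZp.zpExtension 2).layer 2)) ^ (k : ℕ) = 0) :
    ∀ k, c k = 0 := by
  subst hn
  haveI : FiniteDimensional ℚ ↥ℚ⟮θ⟯ :=
    IntermediateField.adjoin.finiteDimensional ⟨_, Cubic.monic_of_a_eq_one', by rwa [← aeval_def]⟩
  haveI : FiniteDimensional ℚ ↥((CyclotomicZp.zpExtension 2).layer 2) := (CyclotomicZp.zpExtension 2).finiteDimensional_layer_holds 2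
  haveI : NumberField ↥ℚ⟮θ⟯ := NumberField.mk
  haveI : NumberField ↥(ℚ⟮θ⟯ ⊔ (CyclotomicZp.zpExtension 2).layer 2) := NumberField.mk
  obtain ⟨-, -, h3⟩ := layer_basics hirr hθ hreal 2
  have hodd3 : Odd (Module.finrank ℚ ↥ℚ⟮θ⟯) := by rw [h3]; decide
  have hK2 : ℚ⟮θ⟯ ≤ ℚ⟮θ⟯ ⊔ (CyclotomicZp.zpExtension 2).layer 2 := le_sup_left
  letI : Algebra ↥ℚ⟮θ⟯ ↥(ℚ⟮θ⟯ ⊔ (CyclotomicZp.zpExtension 2).layer 2) := (IntermediateField.inclusion hK2).toRingHom.toAlgebra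
  have halg : ∀ c, algebraMap ↥ℚ⟮θ⟯ ↥(ℚ⟮θ⟯ ⊔ (CyclotomicZp.zpExtension 2).layer 2) c = IntermediateField.inclusion hK2 c := fun _ => rfl
  haveI : IsScalarTower ℚ ↥ℚ⟮θ⟯ ↥(ℚ⟮θ⟯ ⊔ (CyclotomicZp.zpExtension 2).layer 2) :=
    IsScalarTower.of_algebraMap_eq fun x => ((IntermediateField.inclusion hK2).commutes x).symm
  set e'' : ↥(ℚ⟮θ⟯ ⊔ (CyclotomicZp.zpExtension 2).layer 2) := ⟨e, (le_sup_right : (CyclotomicZp.zpExtension 2).layer 2 ≤ _) he⟩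
    with he''def
  have he''0 : (fun x : ↥(ℚ⟮θ⟯ ⊔ (CyclotomicZp.zpExtension 2).layer 2) => x ^ 2 - 2)^[2] e'' = 0 := by
    apply (algebraMap ↥(ℚ⟮θ⟯ ⊔ (CyclotomicZp.zpExtension 2).layer 2) (AlgebraicClosure ℚ)).injective
    rw [NestedSqrtTwo.map_iterate, map_zero]
    exact he0
  have hmine : minpoly ↥ℚ⟮θ⟯ e'' = ((X ^ 2 - C 2 : (↥ℚ⟮θ⟯)[X]).comp)^[2] X :=
    NestedSqrtTwo.minpoly_eq_of_odd_finrank hodd3 e'' he''0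
  have hnde : (minpoly ↥ℚ⟮θ⟯ e'').natDegree = 4 := by rw [hmine, NestedSqrtTwo.natDegree_eq]; norm_num
  have hce : LinearIndependent ↥ℚ⟮θ⟯ fun k : Fin 4 => e'' ^ (k : ℕ) := by
    have h0 := linearIndependent_pow (K := ↥ℚ⟮θ⟯) e''
    have hcomp : (fun k : Fin 4 => e'' ^ (k : ℕ)) ∘ (finCongr hnde) =
        fun k : Fin (minpoly ↥ℚ⟮θ⟯ e'').natDegree => e'' ^ (k : ℕ) := by
      funext k; simp
    rw [← hcomp] at h0
    exact (linearIndependent_equiv (finCongr hnde)).mp h0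
  exact Fintype.linearIndependent_iff.mp hce c (by
    rw [← hc]
    refine Finset.sum_congr rfl fun k _ => ?_
    rw [Algebra.smul_def, halg])

/-! ## §2 The residue maps `𝓞_{A₂} → 𝔽_ℓ` through the order `ℤ[θ, e]` -/

set_option maxHeartbeats 1600000 in
/-- **Residue maps on the layer-two integers**: for every prime `ℓ ∤ 16·disc(h)` and every pair `(x, y) ∈ 𝔽_ℓ²` with `h(x) = 0`, `Ψ₂(y) = 0`
there is a ring map `φ : 𝓞_{A₂} → 𝔽_ℓ` (`A₂ = ℚ(θ) ⊔ ℚ_2`) with `φ(θ) = x` and `φ(e) = y`.  The abstract order `T = (ℤ[X]/h)[Y]/Ψ₂` maps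
injectively onto `R = ℤ[θ, e] ⊂ A₂` (independence of the `θ^i e^k`), `R` carries the evaluation `X ↦ x, Y ↦ y`, and `N·𝓞_{A₂} ⊆ R` for
`N = 16·disc(h)` extends it by `z ↦ N̄⁻¹ φ₀(N z)`.  KERNEL; no integral basis of the degree-`12` field.
[cite: Marcus1977, Ch. 3 Thm. 27 and Ch. 2 Ex. 41] [cite: NeukirchANT1999, Ch. I §8] [cite: Cohen1993, §4.1.3] -/
theorem exists_ringHom_ringOfIntegers_sup_layer_two_zmod (hirr : Irreducible (Cubic.toPoly ⟨1, (p : ℚ), q, r⟩))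
    (hθ : aeval θ (Cubic.toPoly ⟨1, (p : ℚ), q, r⟩) = 0)
    (hreal : haveI : FiniteDimensional ℚ ↥ℚ⟮θ⟯ :=
        IntermediateField.adjoin.finiteDimensional ⟨_, Cubic.monic_of_a_eq_one', by rwa [← aeval_def]⟩
      haveI : NumberField ↥ℚ⟮θ⟯ := NumberField.mk
      IsTotallyReal ↥ℚ⟮θ⟯)
    {e : AlgebraicClosure ℚ} (he : e ∈ (CyclotomicZp.zpExtension 2).layer 2) (he0 : (fun x : AlgebraicClosure ℚ => x ^ 2 - 2)^[2] e = 0)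
    {ℓ : ℕ} [Fact ℓ.Prime] (hℓ : ((16 * Cubic.discr ⟨1, p, q, r⟩ : ℤ) : ZMod ℓ) ≠ 0)
    {x y : ZMod ℓ} (hx : x ^ 3 + (p : ZMod ℓ) * x ^ 2 + (q : ZMod ℓ) * x + (r : ZMod ℓ) = 0) (hy : y ^ 4 - 4 * y ^ 2 + 2 = 0) :
    ∃ φ : 𝓞 ↥(ℚ⟮θ⟯ ⊔ (CyclotomicZp.zpExtension 2).layer 2) →+* ZMod ℓ,
      (∀ w : 𝓞 ↥(ℚ⟮θ⟯ ⊔ (CyclotomicZp.zpExtension 2).layer 2), (w : ↥(ℚ⟮θ⟯ ⊔ (CyclotomicZp.zpExtension 2).layer 2)) = inclusion (le_sup_left : ℚ⟮θ⟯ ≤ ℚ⟮θ⟯ ⊔ (CyclotomicZp.zpExtension 2).layer 2) (AdjoinSimple.gen ℚ θ) →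
        φ w = x) ∧
      (∀ w : 𝓞 ↥(ℚ⟮θ⟯ ⊔ (CyclotomicZp.zpExtension 2).layer 2), (w : ↥(ℚ⟮θ⟯ ⊔ (CyclotomicZp.zpExtension 2).layer 2)) = (⟨e, (le_sup_right : (CyclotomicZp.zpExtension 2).layer 2 ≤ _) he⟩ : ↥(ℚ⟮θ⟯ ⊔ (CyclotomicZp.zpExtension 2).layer 2)) → φ w = y) := by
  classical
  haveI : FiniteDimensional ℚ ↥ℚ⟮θ⟯ :=
    IntermediateField.adjoin.finiteDimensional ⟨_, Cubic.monic_of_a_eq_one', by rwa [← aeval_def]⟩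
  haveI : FiniteDimensional ℚ ↥((CyclotomicZp.zpExtension 2).layer 2) := (CyclotomicZp.zpExtension 2).finiteDimensional_layer_holds 2
  haveI : NumberField ↥ℚ⟮θ⟯ := NumberField.mk
  haveI : NumberField ↥(ℚ⟮θ⟯ ⊔ (CyclotomicZp.zpExtension 2).layer 2) := NumberField.mk
  have hK2 : ℚ⟮θ⟯ ≤ ℚ⟮θ⟯ ⊔ (CyclotomicZp.zpExtension 2).layer 2 := le_sup_left
  set θ'' : ↥(ℚ⟮θ⟯ ⊔ (CyclotomicZp.zpExtension 2).layer 2) := inclusion hK2 (AdjoinSimple.gen ℚ θ) with hθ''def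
  set e'' : ↥(ℚ⟮θ⟯ ⊔ (CyclotomicZp.zpExtension 2).layer 2) := ⟨e, (le_sup_right : (CyclotomicZp.zpExtension 2).layer 2 ≤ _) he⟩ with he''def
  set ιK : ↥ℚ⟮θ⟯ →+* ↥(ℚ⟮θ⟯ ⊔ (CyclotomicZp.zpExtension 2).layer 2) := (inclusion hK2).toRingHom with hιK
  have hιK : ∀ c, ιK c = inclusion hK2 c := fun _ => rfl
  -- relations of the generators
  have hgenrel : AdjoinSimple.gen ℚ θ ^ 3 + (p : ↥ℚ⟮θ⟯) * AdjoinSimple.gen ℚ θ ^ 2 + (q : ↥ℚ⟮θ⟯) * AdjoinSimple.gen ℚ θ + (r : ↥ℚ⟮θ⟯) = 0 := by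
    apply (algebraMap ↥ℚ⟮θ⟯ (AlgebraicClosure ℚ)).injective
    have h := hθ
    simp only [Cubic.toPoly, map_one, one_mul, aeval_add, aeval_mul, aeval_C, aeval_X_pow, aeval_X, eq_ratCast,
      Rat.cast_intCast] at h
    simp only [map_add, map_mul, map_pow, map_intCast, map_zero, AdjoinSimple.algebraMap_gen]
    exact h
  have he''4 : e'' ^ 4 - 4 * e'' ^ 2 + 2 = 0 := by
    apply (algebraMap ↥(ℚ⟮θ⟯ ⊔ (CyclotomicZp.zpExtension 2).layer 2) (AlgebraicClosure ℚ)).injective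
    have h := he0
    simp only [Function.iterate_succ, Function.iterate_zero, Function.comp_apply, id_eq] at h
    rw [map_add, map_sub, map_mul, map_pow, map_pow, map_ofNat, map_ofNat, map_zero, IntermediateField.algebraMap_apply]
    linear_combination h
  -- the abstract order `T = (ℤ[X]/h)[Y]/Ψ₂` and its maps to `A₂` and to `𝔽_ℓ`
  set hZ : ℤ[X] := X ^ 3 + C p * X ^ 2 + C q * X + C r with hhZ
  have hZm : hZ.Monic := by rw [hhZ]; monicity!
  have hZdeg : hZ.natDegree = 3 := by rw [hhZ]; compute_degree!
  have hrootK : hZ.eval₂ (algebraMap ℤ ↥ℚ⟮θ⟯) (AdjoinSimple.gen ℚ θ) = 0 := by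
    rw [hhZ]; simp only [eval₂_add, eval₂_mul, eval₂_pow, eval₂_C, eval₂_X]; simp only [eq_intCast]
    exact hgenrel
  set ψK : AdjoinRoot hZ →+* ↥ℚ⟮θ⟯ := AdjoinRoot.lift (algebraMap ℤ ↥ℚ⟮θ⟯) (AdjoinSimple.gen ℚ θ) hrootK with hψK
  set ψ₁ : AdjoinRoot hZ →+* ↥(ℚ⟮θ⟯ ⊔ (CyclotomicZp.zpExtension 2).layer 2) := ιK.comp ψK with hψ₁
  haveI : Nontrivial (AdjoinRoot hZ) := AdjoinRoot.nontrivial hZ (by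
    rw [degree_eq_natDegree hZm.ne_zero, hZdeg]; norm_num)
  set Ψ : (AdjoinRoot hZ)[X] := X ^ 4 - C 4 * X ^ 2 + C 2 with hΨ
  have hΨm : Ψ.Monic := by rw [hΨ]; monicity!
  have hΨdeg : Ψ.natDegree = 4 := by rw [hΨ]; compute_degree!
  have hrootE : Ψ.eval₂ ψ₁ e'' = 0 := by
    rw [hΨ]; simp only [eval₂_add, eval₂_sub, eval₂_mul, eval₂_pow, eval₂_C, eval₂_X]; simp only [map_ofNat]
    exact he''4
  set ψ : AdjoinRoot Ψ →+* ↥(ℚ⟮θ⟯ ⊔ (CyclotomicZp.zpExtension 2).layer 2) := AdjoinRoot.lift ψ₁ e'' hrootE with hψ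
  have hrootx : hZ.eval₂ (Int.castRingHom (ZMod ℓ)) x = 0 := by
    rw [hhZ]; simp only [eval₂_add, eval₂_mul, eval₂_pow, eval₂_C, eval₂_X]; simp only [eq_intCast]
    exact hx
  set χ₁ : AdjoinRoot hZ →+* ZMod ℓ := AdjoinRoot.lift (Int.castRingHom (ZMod ℓ)) x hrootx with hχ₁
  have hrooty : Ψ.eval₂ χ₁ y = 0 := by
    rw [hΨ]; simp only [eval₂_add, eval₂_sub, eval₂_mul, eval₂_pow, eval₂_C, eval₂_X]; simp only [map_ofNat]
    exact hy
  set χ : AdjoinRoot Ψ →+* ZMod ℓ := AdjoinRoot.lift χ₁ y hrooty with hχ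
  -- values on generators
  have hψ_of : ∀ c, ψ (AdjoinRoot.of Ψ c) = ιK (ψK c) := fun c => by rw [hψ, AdjoinRoot.lift_of, hψ₁, RingHom.comp_apply]
  have hψ_root : ψ (AdjoinRoot.root Ψ) = e'' := by rw [hψ, AdjoinRoot.lift_root]
  have hψK_root : ψK (AdjoinRoot.root hZ) = AdjoinSimple.gen ℚ θ := by rw [hψK, AdjoinRoot.lift_root]
  have hψ_X : ψ (AdjoinRoot.of Ψ (AdjoinRoot.root hZ)) = θ'' := by rw [hψ_of, hψK_root, hιK]
  have hχ_of : ∀ c, χ (AdjoinRoot.of Ψ c) = χ₁ c := fun c => by rw [hχ, AdjoinRoot.lift_of]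
  have hχ_root : χ (AdjoinRoot.root Ψ) = y := by rw [hχ, AdjoinRoot.lift_root]
  have hχ₁_root : χ₁ (AdjoinRoot.root hZ) = x := by rw [hχ₁, AdjoinRoot.lift_root]
  -- injectivity of `ψK` and `ψ` (power bases + independence)
  set pbS := AdjoinRoot.powerBasis' hZm with hpbS
  set pbT := AdjoinRoot.powerBasis' hΨm with hpbT
  have hgenS : pbS.gen = AdjoinRoot.root hZ := by rw [hpbS, AdjoinRoot.powerBasis'_gen]
  have hgenT : pbT.gen = AdjoinRoot.root Ψ := by rw [hpbT, AdjoinRoot.powerBasis'_gen]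
  have hψK_inj : ∀ c : AdjoinRoot hZ, ψK c = 0 → c = 0 := by
    intro c hc
    have hrepr := pbS.basis.sum_repr c
    have hsum : ∑ i : Fin pbS.dim, ((pbS.basis.repr c i : ℤ) : ↥ℚ⟮θ⟯) * AdjoinSimple.gen ℚ θ ^ (i : ℕ) = 0 := by
      rw [← hc]
      conv_rhs => rw [← hrepr]
      rw [map_sum]
      refine Finset.sum_congr rfl fun i _ => ?_
      rw [map_zsmul, PowerBasis.coe_basis, map_pow, hgenS, hψK_root, zsmul_eq_mul]
    have hdimS : pbS.dim = 3 := by rw [hpbS, AdjoinRoot.powerBasis'_dim, hZdeg]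
    have h0 := forall_eq_zero_of_sum_pow_gen_eq_zero hirr hθ hdimS _ hsum
    rw [← hrepr]
    exact Finset.sum_eq_zero fun i _ => by rw [h0 i, zero_smul]
  have hψ_inj : Function.Injective ψ := by
    rw [injective_iff_map_eq_zero]
    intro w hw
    have hrepr := pbT.basis.sum_repr w
    have hsum : ∑ k : Fin pbT.dim, inclusion hK2 (ψK (pbT.basis.repr w k)) * e'' ^ (k : ℕ) = 0 := by
      rw [← hw]
      conv_rhs => rw [← hrepr]
      rw [map_sum]
      refine Finset.sum_congr rfl fun k _ => ?_
      rw [Algebra.smul_def, AdjoinRoot.algebraMap_eq, map_mul, hψ_of, PowerBasis.coe_basis, map_pow, hgenT, hψ_root, hιK]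
    have hdimT : pbT.dim = 4 := by rw [hpbT, AdjoinRoot.powerBasis'_dim, hΨdeg]
    have h0 := forall_eq_zero_of_sum_pow_layer_two_eq_zero hirr hθ hreal he he0 hdimT _ hsum
    rw [← hrepr]
    exact Finset.sum_eq_zero fun k _ => by rw [hψK_inj _ (h0 k), zero_smul]
  -- the order `R = ℤ[θ, e]` and its residue map `φ₀`
  have hinjR : Function.Injective ψ.rangeRestrict := fun a b hab =>
    hψ_inj (by rw [← RingHom.coe_rangeRestrict ψ a, ← RingHom.coe_rangeRestrict ψ b, hab])
  set eqv : AdjoinRoot Ψ ≃+* ψ.range := RingEquiv.ofBijective ψ.rangeRestrict ⟨hinjR, ψ.rangeRestrict_surjective⟩ with heqv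
  set φ₀ : ψ.range →+* ZMod ℓ := χ.comp eqv.symm.toRingHom with hφ₀
  have hφ₀ : ∀ (w : AdjoinRoot Ψ) (hw : ψ w ∈ ψ.range), φ₀ ⟨ψ w, hw⟩ = χ w := by
    intro w hw
    have h1 : (⟨ψ w, hw⟩ : ψ.range) = eqv w := Subtype.ext (by rw [heqv, RingEquiv.ofBijective_apply, RingHom.coe_rangeRestrict])
    rw [h1, hφ₀]
    simp
  -- `N · 𝓞_{A₂} ⊆ R`
  set N : ℤ := 16 * Cubic.discr ⟨1, p, q, r⟩ with hN
  have hNmem : ∀ z : 𝓞 ↥(ℚ⟮θ⟯ ⊔ (CyclotomicZp.zpExtension 2).layer 2), ∃ w : AdjoinRoot Ψ, ψ w = (N : ↥(ℚ⟮θ⟯ ⊔ (CyclotomicZp.zpExtension 2).layer 2)) * z := by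
    intro z
    obtain ⟨c, hc⟩ := sixteen_mul_discr_mul_eq_sum_sup_layer_two hirr hθ hreal he he0 z
    refine ⟨∑ i : Fin 3, ∑ k : Fin 4, (c i k : AdjoinRoot Ψ) * AdjoinRoot.of Ψ (AdjoinRoot.root hZ) ^ (i : ℕ) *
      AdjoinRoot.root Ψ ^ (k : ℕ), ?_⟩
    rw [hN, hc, map_sum]
    refine Finset.sum_congr rfl fun i _ => ?_
    rw [map_sum]
    refine Finset.sum_congr rfl fun k _ => ?_
    rw [map_mul, map_mul, map_pow, map_pow, map_intCast, hψ_X, hψ_root, hθ''def, he''def, mul_assoc]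
  have hNbar : ((N : ℤ) : ZMod ℓ) ≠ 0 := hℓ
  -- `ι z = N z ∈ R` and the extension `φ z = N̄⁻¹ φ₀ (N z)`
  let ι : 𝓞 ↥(ℚ⟮θ⟯ ⊔ (CyclotomicZp.zpExtension 2).layer 2) → ψ.range := fun z => ⟨(N : ↥(ℚ⟮θ⟯ ⊔ (CyclotomicZp.zpExtension 2).layer 2)) * z, by obtain ⟨w, hw⟩ := hNmem z; exact ⟨w, hw⟩⟩
  have hι_coe : ∀ z : 𝓞 ↥(ℚ⟮θ⟯ ⊔ (CyclotomicZp.zpExtension 2).layer 2), ((ι z : ψ.range) : ↥(ℚ⟮θ⟯ ⊔ (CyclotomicZp.zpExtension 2).layer 2)) = (N : ↥(ℚ⟮θ⟯ ⊔ (CyclotomicZp.zpExtension 2).layer 2)) * z := fun z => rfl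
  have hNR : ((N : ψ.range) : ↥(ℚ⟮θ⟯ ⊔ (CyclotomicZp.zpExtension 2).layer 2)) = (N : ↥(ℚ⟮θ⟯ ⊔ (CyclotomicZp.zpExtension 2).layer 2)) := by simp
  have hι_one : ι 1 = (N : ψ.range) := Subtype.ext (by
    rw [hι_coe, hNR, NumberField.RingOfIntegers.coe_eq_algebraMap, map_one, mul_one])
  have hι_mul : ∀ z w : 𝓞 ↥(ℚ⟮θ⟯ ⊔ (CyclotomicZp.zpExtension 2).layer 2), ι z * ι w = ι (z * w) * (N : ψ.range) := fun z w => Subtype.ext (by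
    simp only [MulMemClass.coe_mul, hι_coe, hNR, NumberField.RingOfIntegers.coe_eq_algebraMap, map_mul]; ring)
  have hι_add : ∀ z w : 𝓞 ↥(ℚ⟮θ⟯ ⊔ (CyclotomicZp.zpExtension 2).layer 2), ι (z + w) = ι z + ι w := fun z w => Subtype.ext (by
    simp only [AddMemClass.coe_add, hι_coe, NumberField.RingOfIntegers.coe_eq_algebraMap, map_add]; ring)
  have hι_zero : ι 0 = 0 := Subtype.ext (by
    rw [hι_coe, ZeroMemClass.coe_zero, NumberField.RingOfIntegers.coe_eq_algebraMap, map_zero, mul_zero])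
  have hφ₀N : φ₀ (N : ψ.range) = (N : ZMod ℓ) := map_intCast φ₀ N
  refine ⟨{ toFun := fun z => ((N : ℤ) : ZMod ℓ)⁻¹ * φ₀ (ι z)
            map_one' := ?_, map_mul' := ?_, map_zero' := ?_, map_add' := ?_ }, ?_, ?_⟩
  · rw [hι_one, hφ₀N, inv_mul_cancel₀ hNbar]
  · intro z w
    have key : φ₀ (ι z) * φ₀ (ι w) = φ₀ (ι (z * w)) * (N : ZMod ℓ) := by
      rw [← map_mul, hι_mul, map_mul, hφ₀N]
    calc ((N : ℤ) : ZMod ℓ)⁻¹ * φ₀ (ι (z * w))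
        = ((N : ℤ) : ZMod ℓ)⁻¹ * ((N : ℤ) : ZMod ℓ)⁻¹ * (φ₀ (ι (z * w)) * (N : ZMod ℓ)) := by
          field_simp
      _ = ((N : ℤ) : ZMod ℓ)⁻¹ * φ₀ (ι z) * (((N : ℤ) : ZMod ℓ)⁻¹ * φ₀ (ι w)) := by
          rw [← key]; ring
  · rw [hι_zero, map_zero, mul_zero]
  · intro z w
    rw [hι_add, map_add, mul_add]
  · -- value at `θ`
    intro w hw
    show ((N : ℤ) : ZMod ℓ)⁻¹ * φ₀ (ι w) = x
    have hmemw : ψ ((N : AdjoinRoot Ψ) * AdjoinRoot.of Ψ (AdjoinRoot.root hZ)) ∈ ψ.range := ⟨_, rfl⟩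
    have h1 : ι w = ⟨ψ ((N : AdjoinRoot Ψ) * AdjoinRoot.of Ψ (AdjoinRoot.root hZ)), hmemw⟩ :=
      Subtype.ext (by
        show (N : ↥(ℚ⟮θ⟯ ⊔ (CyclotomicZp.zpExtension 2).layer 2)) * (w : ↥(ℚ⟮θ⟯ ⊔ (CyclotomicZp.zpExtension 2).layer 2)) = ψ ((N : AdjoinRoot Ψ) * AdjoinRoot.of Ψ (AdjoinRoot.root hZ))
        rw [map_mul, map_intCast, hψ_X, hw])
    rw [h1, hφ₀, map_mul, map_intCast, hχ_of, hχ₁_root, ← mul_assoc, inv_mul_cancel₀ hNbar, one_mul]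
  · -- value at `e`
    intro w hw
    show ((N : ℤ) : ZMod ℓ)⁻¹ * φ₀ (ι w) = y
    have hmemw : ψ ((N : AdjoinRoot Ψ) * AdjoinRoot.root Ψ) ∈ ψ.range := ⟨_, rfl⟩
    have h1 : ι w = ⟨ψ ((N : AdjoinRoot Ψ) * AdjoinRoot.root Ψ), hmemw⟩ :=
      Subtype.ext (by
        show (N : ↥(ℚ⟮θ⟯ ⊔ (CyclotomicZp.zpExtension 2).layer 2)) * (w : ↥(ℚ⟮θ⟯ ⊔ (CyclotomicZp.zpExtension 2).layer 2)) = ψ ((N : AdjoinRoot Ψ) * AdjoinRoot.root Ψ)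
        rw [map_mul, map_intCast, hψ_root, hw])
    rw [h1, hφ₀, map_mul, map_intCast, hχ_root, ← mul_assoc, inv_mul_cancel₀ hNbar, one_mul]


/-! ## §3 Instance-free form (the primality of `ℓ` as a hypothesis) -/

/-- **Residue maps on the layer-two integers, instance-free form**: as `exists_ringHom_ringOfIntegers_sup_layer_two_zmod`, with the primality of
`ℓ` an explicit hypothesis rather than a `Fact` instance — so that callers evaluate closed `𝔽_ℓ`-arithmetic by `decide` without a local instance in
scope. [cite: Marcus1977, Ch. 3 Thm. 27] [cite: Cohen1993, §4.1.3] -/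
theorem exists_ringHom_ringOfIntegers_sup_layer_two_zmod' (hirr : Irreducible (Cubic.toPoly ⟨1, (p : ℚ), q, r⟩))
    (hθ : aeval θ (Cubic.toPoly ⟨1, (p : ℚ), q, r⟩) = 0)
    (hreal : haveI : FiniteDimensional ℚ ↥ℚ⟮θ⟯ :=
        IntermediateField.adjoin.finiteDimensional ⟨_, Cubic.monic_of_a_eq_one', by rwa [← aeval_def]⟩
      haveI : NumberField ↥ℚ⟮θ⟯ := NumberField.mk
      IsTotallyReal ↥ℚ⟮θ⟯)
    {e : AlgebraicClosure ℚ} (he : e ∈ (CyclotomicZp.zpExtension 2).layer 2) (he0 : (fun x : AlgebraicClosure ℚ => x ^ 2 - 2)^[2] e = 0)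
    {ℓ : ℕ} (hℓp : ℓ.Prime) (hℓ : ((16 * Cubic.discr ⟨1, p, q, r⟩ : ℤ) : ZMod ℓ) ≠ 0)
    {x y : ZMod ℓ} (hx : x ^ 3 + (p : ZMod ℓ) * x ^ 2 + (q : ZMod ℓ) * x + (r : ZMod ℓ) = 0) (hy : y ^ 4 - 4 * y ^ 2 + 2 = 0) :
    ∃ φ : 𝓞 ↥(ℚ⟮θ⟯ ⊔ (CyclotomicZp.zpExtension 2).layer 2) →+* ZMod ℓ,
      (∀ w : 𝓞 ↥(ℚ⟮θ⟯ ⊔ (CyclotomicZp.zpExtension 2).layer 2), (w : ↥(ℚ⟮θ⟯ ⊔ (CyclotomicZp.zpExtension 2).layer 2)) = inclusion (le_sup_left : ℚ⟮θ⟯ ≤ ℚ⟮θ⟯ ⊔ (CyclotomicZp.zpExtension 2).layer 2) (AdjoinSimple.gen ℚ θ) →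
        φ w = x) ∧
      (∀ w : 𝓞 ↥(ℚ⟮θ⟯ ⊔ (CyclotomicZp.zpExtension 2).layer 2), (w : ↥(ℚ⟮θ⟯ ⊔ (CyclotomicZp.zpExtension 2).layer 2)) = (⟨e, (le_sup_right : (CyclotomicZp.zpExtension 2).layer 2 ≤ _) he⟩ : ↥(ℚ⟮θ⟯ ⊔ (CyclotomicZp.zpExtension 2).layer 2)) → φ w = y) := by
  haveI : Fact ℓ.Prime := ⟨hℓp⟩
  exact exists_ringHom_ringOfIntegers_sup_layer_two_zmod hirr hθ hreal he he0 hℓ hx hy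

end Summit.BirchSwinnertonDyer.BirchSwinnertonDyer.Theorems.AddKatoTwo

end
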